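import Mathlib
import HarnessLib

/-!
# Route `KLProgramme`, crux K3 (stmt-HubbardSuperconductivity-19937) — two-shell GAIN PROFILES indexed by
# (scale, READING RESOLUTION, centre transfer) and their uniform summability (the amended `GeoConsts.WF` freezing clauses)

Cell gate-hubbard-kl, seat p1b (E.1/E.3 owner; child-1 co-owner), g3.  Text: HOME/prover-p1b/GAINS-NOTE.md §0.3, §1 (Δ7).
An isotropic label 4-tuple at resolution `m` (sector width `π4^{-m}`) fixes its pp / ph transfers only up to the TUPLE SPREAD
`w4^{-m}`; the scale-`n` two-shell bubble (`Λ_n = e₀4^{-n}`) read on the tuple is bounded by the sup of the pointwise bound over the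
transfer RANGE `[ρ - w4^{-m}, ρ + w4^{-m}]`, `ρ` the CENTRE transfer's torus size.  Profiles and the two sums child 1 consumes:
* `ppGainOf C₁ C₂ w e₀ n m ρ` (Lemma E.1/E.3's uniform law on the range, `1` if the range meets the Cooper point);
  `klgp_sum_Ioc_ppGainOf_le`: `4^{-(t+1)} < ρ ⟹ Σ_{n ∈ (t, m]} ppGainOf … n m ρ ≤ 2w + 1 + (8/3)C₁e₀ + C₂√e₀`.
* `phGainOf C₀ K C₁ C₂ w e₀ n m ρ` (min of: `1`; Lemma E.2 (iv)(a) below resolution `C₀4^{-n} + K(ρ + w4^{-m})/Λ_n`; Lemma E.3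
  above resolution `C₁Λ_n/(ρ - w4^{-m}) + C₂√Λ_n`);  `klgp_sum_range_phGainOf_le`: for EVERY `ρ ≥ 0` and `m`,
  `Σ_{n ≤ m} phGainOf … n m ρ ≤ (4/3)C₀ + 4/3 + 4C₁K + 2C₂√e₀ + 3Kw/e₀ + 1` (the `≈ log₄(3Kw/e₀)` unresolved scales just above the
  reading resolution cost `≤ 1` each; with an `m`-INDEPENDENT profile read at `m = n` EVERY scale would be unresolved — Δ7).
Pure real analysis; the engine instantiates `G.ppGain/phGain` with these and owes only «bubble on the tuple ≤ profile».
References: HOME/prover-p1b/GAINS-NOTE.md, E1-NOTE.md §2; HOME/p1/E2-NOTE.md §2 (iv), §6.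
-/
noncomputable section

namespace Summit.HubbardSuperconductivity.HubbardSuperconductivity.Theorems

set_option linter.dupNamespace false -- summit = problem name (single-conjunct summit), D-0017

open Real Finset

/-- `k < 4^k`. -/
theorem klgp_lt_four_pow (k : ℕ) : k < 4 ^ k := by
  induction k with
  | zero => simp
  | succ k ih => rw [pow_succ]; omega

/-- `(4^n)⁻¹` is antitone in `n`. -/
theorem klgp_inv_four_pow_anti {n m : ℕ} (h : n ≤ m) : ((4 : ℝ) ^ m)⁻¹ ≤ ((4 : ℝ) ^ n)⁻¹ := by
  have h4 : (4 : ℝ) ^ n ≤ (4 : ℝ) ^ m := pow_le_pow_right₀ (by norm_num) h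
  have hn : 0 < (4 : ℝ) ^ n := by positivity
  exact inv_anti₀ hn h4

/-- Geometric window sum `Σ_{n ∈ Ioc t m} (4^n)⁻¹ ≤ (4/3)·(4^{t+1})⁻¹`. -/
theorem klgp_sum_Ioc_inv_four_pow_le (t m : ℕ) :
    ∑ n ∈ Ioc t m, ((4 : ℝ) ^ n)⁻¹ ≤ 4 / 3 * ((4 : ℝ) ^ (t + 1))⁻¹ := by
  have hI : Ioc t m = Ico (t + 1) (m + 1) := by ext n; simp only [mem_Ioc, mem_Ico]; omega
  rw [hI]
  have h : ∑ n ∈ Ico (t + 1) (m + 1), ((4 : ℝ) ^ n)⁻¹ = ∑ n ∈ Ico (t + 1) (m + 1), (1 / 4 : ℝ) ^ n :=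
    sum_congr rfl fun n _ => by rw [one_div, inv_pow]
  rw [h]
  calc ∑ n ∈ Ico (t + 1) (m + 1), (1 / 4 : ℝ) ^ n ≤ (1 / 4 : ℝ) ^ (t + 1) / (1 - 1 / 4) :=
        geom_sum_Ico_le_of_lt_one (by norm_num) (by norm_num)
    _ = 4 / 3 * ((4 : ℝ) ^ (t + 1))⁻¹ := by rw [one_div, inv_pow]; ring

/-- Geometric window sum `Σ_{n ∈ Ioc t m} (2^n)⁻¹ ≤ 1`. -/
theorem klgp_sum_Ioc_inv_two_pow_le (t m : ℕ) : ∑ n ∈ Ioc t m, ((2 : ℝ) ^ n)⁻¹ ≤ 1 := by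
  have hI : Ioc t m = Ico (t + 1) (m + 1) := by ext n; simp only [mem_Ioc, mem_Ico]; omega
  rw [hI]
  have h : ∑ n ∈ Ico (t + 1) (m + 1), ((2 : ℝ) ^ n)⁻¹ = ∑ n ∈ Ico (t + 1) (m + 1), (1 / 2 : ℝ) ^ n :=
    sum_congr rfl fun n _ => by rw [one_div, inv_pow]
  rw [h]
  calc ∑ n ∈ Ico (t + 1) (m + 1), (1 / 2 : ℝ) ^ n ≤ (1 / 2 : ℝ) ^ (t + 1) / (1 - 1 / 2) :=
        geom_sum_Ico_le_of_lt_one (by norm_num) (by norm_num)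
    _ = (1 / 2 : ℝ) ^ t := by rw [pow_succ]; ring
    _ ≤ 1 := pow_le_one₀ (by norm_num) (by norm_num)

/-- Geometric sum over all scales `Σ_{n < b} (2^n)⁻¹ ≤ 2`. -/
theorem klgp_sum_range_inv_two_pow_le (b : ℕ) : ∑ n ∈ range b, ((2 : ℝ) ^ n)⁻¹ ≤ 2 := by
  have h : ∑ n ∈ range b, ((2 : ℝ) ^ n)⁻¹ = ∑ n ∈ range b, (1 / 2 : ℝ) ^ n :=
    sum_congr rfl fun n _ => by rw [one_div, inv_pow]
  rw [h, ← Nat.Ico_zero_eq_range]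
  calc ∑ n ∈ Ico 0 b, (1 / 2 : ℝ) ^ n ≤ (1 / 2 : ℝ) ^ 0 / (1 - 1 / 2) :=
        geom_sum_Ico_le_of_lt_one (by norm_num) (by norm_num)
    _ = 2 := by norm_num

/-- **The particle–particle two-shell gain profile** at scale `n`, read at resolution `m`, centre pp-transfer size `ρ`
(Lemma E.1/E.3, uniform clause, over the tuple's transfer range): `min{1, C₁Λ_n/(ρ - w4^{-m}) + C₂√Λ_n}` (`Λ_n = e₀4^{-n}`,
`√Λ_n = √e₀·2^{-n}`) when the range misses the Cooper point, `1` otherwise. -/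
def ppGainOf (C₁ C₂ w e₀ : ℝ) (n m : ℕ) (ρ : ℝ) : ℝ :=
  if w * ((4 : ℝ) ^ m)⁻¹ < ρ then
    min 1 (C₁ * (e₀ * ((4 : ℝ) ^ n)⁻¹) / (ρ - w * ((4 : ℝ) ^ m)⁻¹) + C₂ * Real.sqrt e₀ * ((2 : ℝ) ^ n)⁻¹)
  else 1

/-- The pp profile is at most `1`. -/
theorem klgp_ppGainOf_le_one (C₁ C₂ w e₀ : ℝ) (n m : ℕ) (ρ : ℝ) : ppGainOf C₁ C₂ w e₀ n m ρ ≤ 1 := by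
  unfold ppGainOf; split_ifs
  · exact min_le_left _ _
  · exact le_rfl

/-- The pp profile is nonnegative. -/
theorem klgp_ppGainOf_nonneg {C₁ C₂ e₀ : ℝ} (hC₁ : 0 ≤ C₁) (hC₂ : 0 ≤ C₂) (he : 0 ≤ e₀) (w : ℝ) (n m : ℕ) (ρ : ℝ) :
    0 ≤ ppGainOf C₁ C₂ w e₀ n m ρ := by
  unfold ppGainOf; split_ifs with h
  · refine le_min zero_le_one (add_nonneg (div_nonneg (by positivity) (by linarith)) (by positivity))
  · exact zero_le_one

/-- Far from the Cooper point at the reading resolution (`w4^{-n} < ρ/2`, `n ≤ m`), the pp profile is geometric: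
`≤ 2C₁e₀(4^n)⁻¹/ρ + C₂√e₀(2^n)⁻¹`. -/
theorem klgp_ppGainOf_le_far {C₁ C₂ w e₀ : ℝ} (hC₁ : 0 ≤ C₁) (he : 0 ≤ e₀) (hw : 0 ≤ w) {n m : ℕ} (hnm : n ≤ m)
    {ρ : ℝ} (hfar : w * ((4 : ℝ) ^ n)⁻¹ < ρ / 2) :
    ppGainOf C₁ C₂ w e₀ n m ρ ≤ 2 * C₁ * e₀ * ((4 : ℝ) ^ n)⁻¹ / ρ + C₂ * Real.sqrt e₀ * ((2 : ℝ) ^ n)⁻¹ := by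
  have hwm : w * ((4 : ℝ) ^ m)⁻¹ ≤ w * ((4 : ℝ) ^ n)⁻¹ := mul_le_mul_of_nonneg_left (klgp_inv_four_pow_anti hnm) hw
  have hρ : 0 < ρ := by nlinarith [mul_nonneg hw (inv_nonneg.mpr (pow_nonneg (by norm_num : (0:ℝ) ≤ 4) n))]
  have hden : ρ / 2 ≤ ρ - w * ((4 : ℝ) ^ m)⁻¹ := by linarith
  unfold ppGainOf
  rw [if_pos (by linarith)]
  refine (min_le_right _ _).trans (add_le_add ?_ le_rfl)
  have hnum : 0 ≤ C₁ * (e₀ * ((4 : ℝ) ^ n)⁻¹) := by positivity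
  calc C₁ * (e₀ * ((4 : ℝ) ^ n)⁻¹) / (ρ - w * ((4 : ℝ) ^ m)⁻¹)
      ≤ C₁ * (e₀ * ((4 : ℝ) ^ n)⁻¹) / (ρ / 2) := div_le_div_of_nonneg_left hnum (by positivity) hden
    _ = 2 * C₁ * e₀ * ((4 : ℝ) ^ n)⁻¹ / ρ := by rw [div_div_eq_mul_div]; ring

/-- Near the Cooper point at the reading resolution (`ρ/2 ≤ w4^{-n}`) with the tuple outside the Cooper class at resolution
`t+1` (`4^{-(t+1)} < ρ`), the scale index is pinned: `n ≤ t + 1 + ⌊2w⌋₊`. -/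
theorem klgp_near_scale_le {w ρ : ℝ} {t n : ℕ} (htn : t < n) (hρ : ((4 : ℝ) ^ (t + 1))⁻¹ < ρ)
    (hnear : ρ / 2 ≤ w * ((4 : ℝ) ^ n)⁻¹) : n ≤ t + 1 + ⌊2 * w⌋₊ := by
  -- `4^{n-t-1} < 2w`, hence `n - t - 1 < 2w`
  obtain ⟨k, rfl⟩ : ∃ k, n = t + 1 + k := ⟨n - t - 1, by omega⟩
  have h4k : (4 : ℝ) ^ (t + 1 + k) = (4 : ℝ) ^ (t + 1) * (4 : ℝ) ^ k := pow_add _ _ _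
  have hpos : 0 < (4 : ℝ) ^ (t + 1) := by positivity
  have hposk : 0 < (4 : ℝ) ^ k := by positivity
  -- from `4^{-(t+1)} < ρ ≤ 2w·4^{-(t+1+k)}` get `4^k < 2w`
  have h1 : ((4 : ℝ) ^ (t + 1))⁻¹ < 2 * w * (((4 : ℝ) ^ (t + 1))⁻¹ * ((4 : ℝ) ^ k)⁻¹) := by
    rw [h4k, mul_inv] at hnear; linarith
  have h2 : (4 : ℝ) ^ k < 2 * w := by
    have := mul_lt_mul_of_pos_right h1 (mul_pos hpos hposk)
    field_simp at this
    linarith [this]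
  have h3 : (k : ℝ) < 2 * w := lt_trans (by exact_mod_cast klgp_lt_four_pow k) h2
  have h4 : k ≤ ⌊2 * w⌋₊ := Nat.le_floor (le_of_lt h3)
  omega

/-- **The particle–particle freezing sum, uniform in the reading resolution and the transfer** (the amended `GeoConsts.WF`
pp clause for this profile): if the tuple is outside the Cooper class at resolution `t+1` (`4^{-(t+1)} < ρ`), then
`Σ_{n ∈ (t, m]} ppGainOf C₁ C₂ w e₀ n m ρ ≤ 2w + 1 + (8/3)C₁e₀ + C₂√e₀`. -/
theorem klgp_sum_Ioc_ppGainOf_le {C₁ C₂ w e₀ : ℝ} (hC₁ : 0 ≤ C₁) (hC₂ : 0 ≤ C₂) (hw : 0 ≤ w) (he : 0 ≤ e₀)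
    (m t : ℕ) {ρ : ℝ} (hρ : ((4 : ℝ) ^ (t + 1))⁻¹ < ρ) :
    ∑ n ∈ Ioc t m, ppGainOf C₁ C₂ w e₀ n m ρ ≤ 2 * w + 1 + 8 / 3 * C₁ * e₀ + C₂ * Real.sqrt e₀ := by
  classical
  have hρpos : 0 < ρ := lt_trans (by positivity) hρ
  set near : ℕ → Prop := fun n => ρ / 2 ≤ w * ((4 : ℝ) ^ n)⁻¹ with hnear_def
  rw [← sum_filter_add_sum_filter_not (Ioc t m) near]
  -- near part: at most `⌊2w⌋₊ + 1` terms, each `≤ 1`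
  have hnear : ∑ n ∈ (Ioc t m).filter near, ppGainOf C₁ C₂ w e₀ n m ρ ≤ 2 * w + 1 := by
    calc ∑ n ∈ (Ioc t m).filter near, ppGainOf C₁ C₂ w e₀ n m ρ
        ≤ ∑ n ∈ (Ioc t m).filter near, (1 : ℝ) := sum_le_sum fun n _ => klgp_ppGainOf_le_one _ _ _ _ _ _ _
      _ = ((Ioc t m).filter near).card := by simp
      _ ≤ (Ioc t (t + 1 + ⌊2 * w⌋₊)).card := by
          exact_mod_cast card_le_card fun n hn => by
            rw [mem_filter, mem_Ioc] at hn
            rw [mem_Ioc]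
            exact ⟨hn.1.1, klgp_near_scale_le hn.1.1 hρ hn.2⟩
      _ = ⌊2 * w⌋₊ + 1 := by
          rw [Nat.card_Ioc]
          have hsub : t + 1 + ⌊2 * w⌋₊ - t = ⌊2 * w⌋₊ + 1 := by omega
          rw [hsub]; push_cast; ring
      _ ≤ 2 * w + 1 := by linarith [Nat.floor_le (by positivity : 0 ≤ 2 * w)]
  -- far part: geometric
  have hfar : ∑ n ∈ (Ioc t m).filter (fun n => ¬ near n), ppGainOf C₁ C₂ w e₀ n m ρ ≤
      8 / 3 * C₁ * e₀ + C₂ * Real.sqrt e₀ := by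
    calc ∑ n ∈ (Ioc t m).filter (fun n => ¬ near n), ppGainOf C₁ C₂ w e₀ n m ρ
        ≤ ∑ n ∈ (Ioc t m).filter (fun n => ¬ near n),
            (2 * C₁ * e₀ * ((4 : ℝ) ^ n)⁻¹ / ρ + C₂ * Real.sqrt e₀ * ((2 : ℝ) ^ n)⁻¹) := by
          refine sum_le_sum fun n hn => ?_
          rw [mem_filter, mem_Ioc] at hn
          exact klgp_ppGainOf_le_far hC₁ he hw hn.1.2 (lt_of_not_ge hn.2)
      _ ≤ ∑ n ∈ Ioc t m, (2 * C₁ * e₀ * ((4 : ℝ) ^ n)⁻¹ / ρ + C₂ * Real.sqrt e₀ * ((2 : ℝ) ^ n)⁻¹) :=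
          sum_le_sum_of_subset_of_nonneg (filter_subset _ _) fun n _ _ => by positivity
      _ = 2 * C₁ * e₀ / ρ * ∑ n ∈ Ioc t m, ((4 : ℝ) ^ n)⁻¹ + C₂ * Real.sqrt e₀ * ∑ n ∈ Ioc t m, ((2 : ℝ) ^ n)⁻¹ := by
          rw [sum_add_distrib, mul_sum, mul_sum]
          congr 1
          exact sum_congr rfl fun n _ => by ring
      _ ≤ 2 * C₁ * e₀ / ρ * (4 / 3 * ((4 : ℝ) ^ (t + 1))⁻¹) + C₂ * Real.sqrt e₀ * 1 := by
          gcongr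
          · exact klgp_sum_Ioc_inv_four_pow_le t m
          · exact klgp_sum_Ioc_inv_two_pow_le t m
      _ = 8 / 3 * C₁ * e₀ * (((4 : ℝ) ^ (t + 1))⁻¹ / ρ) + C₂ * Real.sqrt e₀ := by ring
      _ ≤ 8 / 3 * C₁ * e₀ * 1 + C₂ * Real.sqrt e₀ := by
          gcongr
          exact (div_le_one hρpos).mpr hρ.le
      _ = 8 / 3 * C₁ * e₀ + C₂ * Real.sqrt e₀ := by ring
  linarith

/-- If `a·4ⁿ ≤ 1` on a finite set of scales, then `Σ a·4ⁿ ≤ 4/3` (the set lies below its maximum, where the geometric sum is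
dominated by its last term). -/
theorem klgp_sum_mul_four_pow_le (S : Finset ℕ) {a : ℝ} (ha : 0 ≤ a) (hS : ∀ n ∈ S, a * (4 : ℝ) ^ n ≤ 1) :
    ∑ n ∈ S, a * (4 : ℝ) ^ n ≤ 4 / 3 := by
  rcases S.eq_empty_or_nonempty with h | hne
  · rw [h, sum_empty]; norm_num
  · set N := S.max' hne with hN
    have hsub : S ⊆ range (N + 1) := fun n hn => mem_range.mpr (Nat.lt_succ_of_le (S.le_max' n hn))
    have hNmem : N ∈ S := S.max'_mem hne
    calc ∑ n ∈ S, a * (4 : ℝ) ^ n ≤ ∑ n ∈ range (N + 1), a * (4 : ℝ) ^ n :=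
          sum_le_sum_of_subset_of_nonneg hsub fun n _ _ => by positivity
      _ = a * (((4 : ℝ) ^ (N + 1) - 1) / (4 - 1)) := by rw [← mul_sum, geom_sum_eq (by norm_num) (N + 1)]
      _ ≤ a * ((4 : ℝ) ^ (N + 1) / 3) := by
          refine mul_le_mul_of_nonneg_left ?_ ha
          norm_num
          linarith [pow_nonneg (by norm_num : (0 : ℝ) ≤ 4) (N + 1)]
      _ = 4 / 3 * (a * (4 : ℝ) ^ N) := by rw [pow_succ]; ring
      _ ≤ 4 / 3 * 1 := by gcongr; exact hS N hNmem
      _ = 4 / 3 := by norm_num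

/-- If `(4ⁿ)⁻¹ ≤ c` on a finite set of scales, then `Σ (4ⁿ)⁻¹ ≤ (4/3)·c` (the set lies above its minimum, where the geometric
tail starts). -/
theorem klgp_sum_inv_four_pow_le_of_le (S : Finset ℕ) {c : ℝ} (hc : 0 ≤ c) (hS : ∀ n ∈ S, ((4 : ℝ) ^ n)⁻¹ ≤ c) :
    ∑ n ∈ S, ((4 : ℝ) ^ n)⁻¹ ≤ 4 / 3 * c := by
  rcases S.eq_empty_or_nonempty with h | hne
  · simp [h]; positivity
  · set n₁ := S.min' hne with hn₁
    set N := S.max' hne with hN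
    have hsub : S ⊆ Ico n₁ (N + 1) := fun n hn =>
      mem_Ico.mpr ⟨S.min'_le n hn, Nat.lt_succ_of_le (S.le_max' n hn)⟩
    have hmem : n₁ ∈ S := S.min'_mem hne
    have h : ∑ n ∈ Ico n₁ (N + 1), ((4 : ℝ) ^ n)⁻¹ = ∑ n ∈ Ico n₁ (N + 1), (1 / 4 : ℝ) ^ n :=
      sum_congr rfl fun n _ => by rw [one_div, inv_pow]
    calc ∑ n ∈ S, ((4 : ℝ) ^ n)⁻¹ ≤ ∑ n ∈ Ico n₁ (N + 1), ((4 : ℝ) ^ n)⁻¹ :=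
          sum_le_sum_of_subset_of_nonneg hsub fun n _ _ => by positivity
      _ ≤ (1 / 4 : ℝ) ^ n₁ / (1 - 1 / 4) := by rw [h]; exact geom_sum_Ico_le_of_lt_one (by norm_num) (by norm_num)
      _ = 4 / 3 * ((4 : ℝ) ^ n₁)⁻¹ := by rw [one_div, inv_pow]; ring
      _ ≤ 4 / 3 * c := by gcongr; exact hS n₁ hmem

/-- `Σ_{n ≤ m} (4ⁿ)⁻¹ ≤ 4/3`. -/
theorem klgp_sum_range_inv_four_pow_le (b : ℕ) : ∑ n ∈ range b, ((4 : ℝ) ^ n)⁻¹ ≤ 4 / 3 := by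
  have h : ∑ n ∈ range b, ((4 : ℝ) ^ n)⁻¹ = ∑ n ∈ range b, (1 / 4 : ℝ) ^ n :=
    sum_congr rfl fun n _ => by rw [one_div, inv_pow]
  rw [h, ← Nat.Ico_zero_eq_range]
  calc ∑ n ∈ Ico 0 b, (1 / 4 : ℝ) ^ n ≤ (1 / 4 : ℝ) ^ 0 / (1 - 1 / 4) :=
        geom_sum_Ico_le_of_lt_one (by norm_num) (by norm_num)
    _ = 4 / 3 := by norm_num

/-- **The particle–hole two-shell gain profile** at scale `n`, read at resolution `m`, centre ph-transfer size `ρ`: the minimum of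
the three pointwise bounds valid at every scale — `1`; Lemma E.2 (iv)(a) «below resolution» `C₀4^{-n} + K·(ρ + w4^{-m})/Λ_n`
(zero-sound remainder + Lipschitz in the transfer, over the tuple's range); Lemma E.3 «above resolution»
`C₁Λ_n/(ρ - w4^{-m}) + C₂√Λ_n` when the range misses zero transfer (`w4^{-m} < ρ`). -/
def phGainOf (C₀ K C₁ C₂ w e₀ : ℝ) (n m : ℕ) (ρ : ℝ) : ℝ :=
  min 1 (min (C₀ * ((4 : ℝ) ^ n)⁻¹ + K * (ρ + w * ((4 : ℝ) ^ m)⁻¹) / e₀ * (4 : ℝ) ^ n)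
    (if w * ((4 : ℝ) ^ m)⁻¹ < ρ then
      C₁ * (e₀ * ((4 : ℝ) ^ n)⁻¹) / (ρ - w * ((4 : ℝ) ^ m)⁻¹) + C₂ * Real.sqrt e₀ * ((2 : ℝ) ^ n)⁻¹
    else 1))

/-- The ph profile is at most `1`. -/
theorem klgp_phGainOf_le_one (C₀ K C₁ C₂ w e₀ : ℝ) (n m : ℕ) (ρ : ℝ) : phGainOf C₀ K C₁ C₂ w e₀ n m ρ ≤ 1 :=
  min_le_left _ _

/-- The ph profile is below the «below-resolution» bound. -/
theorem klgp_phGainOf_le_below (C₀ K C₁ C₂ w e₀ : ℝ) (n m : ℕ) (ρ : ℝ) :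
    phGainOf C₀ K C₁ C₂ w e₀ n m ρ ≤ C₀ * ((4 : ℝ) ^ n)⁻¹ + K * (ρ + w * ((4 : ℝ) ^ m)⁻¹) / e₀ * (4 : ℝ) ^ n :=
  (min_le_right _ _).trans (min_le_left _ _)

/-- The ph profile is below the «above-resolution» bound when the tuple's transfer range misses zero. -/
theorem klgp_phGainOf_le_above (C₀ K C₁ C₂ w e₀ : ℝ) (n m : ℕ) {ρ : ℝ} (h : w * ((4 : ℝ) ^ m)⁻¹ < ρ) :
    phGainOf C₀ K C₁ C₂ w e₀ n m ρ ≤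
      C₁ * (e₀ * ((4 : ℝ) ^ n)⁻¹) / (ρ - w * ((4 : ℝ) ^ m)⁻¹) + C₂ * Real.sqrt e₀ * ((2 : ℝ) ^ n)⁻¹ := by
  refine (min_le_right _ _).trans ((min_le_right _ _).trans ?_)
  rw [if_pos h]

/-- The ph profile is nonnegative. -/
theorem klgp_phGainOf_nonneg {C₀ K C₁ C₂ w e₀ : ℝ} (hC₀ : 0 ≤ C₀) (hK : 0 ≤ K) (hC₁ : 0 ≤ C₁) (hC₂ : 0 ≤ C₂)
    (hw : 0 ≤ w) (he : 0 ≤ e₀) (n m : ℕ) {ρ : ℝ} (hρ : 0 ≤ ρ) : 0 ≤ phGainOf C₀ K C₁ C₂ w e₀ n m ρ := by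
  unfold phGainOf
  refine le_min zero_le_one (le_min (by positivity) ?_)
  split_ifs with h
  · exact add_nonneg (div_nonneg (by positivity) (by linarith)) (by positivity)
  · exact zero_le_one

/-- In the unresolved case (`ρ < 2w4^{-m}`) a scale above the «below-resolution» regime (`1 < K(ρ + w4^{-m})4ⁿ/e₀`, `n ≤ m`)
is within `⌊3Kw/e₀⌋₊` of the reading resolution. -/
theorem klgp_unresolved_scale_ge {K w e₀ ρ : ℝ} (hK : 0 ≤ K) (he : 0 < e₀) {n m : ℕ} (hnm : n ≤ m)
    (hρ : ρ < 2 * w * ((4 : ℝ) ^ m)⁻¹) (hhigh : 1 < K * (ρ + w * ((4 : ℝ) ^ m)⁻¹) / e₀ * (4 : ℝ) ^ n) :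
    m - ⌊3 * K * w / e₀⌋₊ ≤ n := by
  obtain ⟨k, rfl⟩ : ∃ k, m = n + k := ⟨m - n, by omega⟩
  have h4 : (4 : ℝ) ^ (n + k) = (4 : ℝ) ^ n * (4 : ℝ) ^ k := pow_add _ _ _
  have hn : 0 < (4 : ℝ) ^ n := by positivity
  have hk : 0 < (4 : ℝ) ^ k := by positivity
  -- `ρ + w4^{-m} < 3w4^{-m}`
  have hr : ρ + w * ((4 : ℝ) ^ (n + k))⁻¹ < 3 * w * ((4 : ℝ) ^ (n + k))⁻¹ := by linarith
  -- `e₀ < K(ρ + w4^{-m})4ⁿ < 3Kw·4^{-k}`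
  have h1 : e₀ < K * (ρ + w * ((4 : ℝ) ^ (n + k))⁻¹) * (4 : ℝ) ^ n := by
    have := hhigh
    rw [div_mul_eq_mul_div, lt_div_iff₀ he] at this
    linarith
  have h2 : K * (ρ + w * ((4 : ℝ) ^ (n + k))⁻¹) * (4 : ℝ) ^ n ≤ K * (3 * w * ((4 : ℝ) ^ (n + k))⁻¹) * (4 : ℝ) ^ n :=
    mul_le_mul_of_nonneg_right (mul_le_mul_of_nonneg_left hr.le hK) hn.le
  have h3 : K * (3 * w * ((4 : ℝ) ^ (n + k))⁻¹) * (4 : ℝ) ^ n = 3 * K * w * ((4 : ℝ) ^ k)⁻¹ := by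
    rw [h4, mul_inv]; field_simp
  have h5 : e₀ < 3 * K * w * ((4 : ℝ) ^ k)⁻¹ := by linarith
  have h6 : (4 : ℝ) ^ k < 3 * K * w / e₀ := by
    rw [lt_div_iff₀ he]
    have := mul_lt_mul_of_pos_right h5 hk
    field_simp at this
    linarith
  have h7 : (k : ℝ) < 3 * K * w / e₀ := lt_trans (by exact_mod_cast klgp_lt_four_pow k) h6
  have h8 : k ≤ ⌊3 * K * w / e₀⌋₊ := Nat.le_floor (le_of_lt h7)
  omega

/-- **The particle–hole sum over all scales up to the reading resolution, uniform in the resolution and the transfer** (the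
amended `GeoConsts.WF` ph clause for this profile): for every `ρ ≥ 0` and every `m`,
`Σ_{n ≤ m} phGainOf … n m ρ ≤ (4/3)C₀ + 4/3 + 4C₁K + 2C₂√e₀ + 3Kw/e₀ + 1`. -/
theorem klgp_sum_range_phGainOf_le {C₀ K C₁ C₂ w e₀ : ℝ} (hC₀ : 0 ≤ C₀) (hK : 0 ≤ K) (hC₁ : 0 ≤ C₁) (hC₂ : 0 ≤ C₂)
    (hw : 0 ≤ w) (he : 0 < e₀) (m : ℕ) {ρ : ℝ} (hρ : 0 ≤ ρ) :
    ∑ n ∈ range (m + 1), phGainOf C₀ K C₁ C₂ w e₀ n m ρ ≤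
      4 / 3 * C₀ + 4 / 3 + 4 * C₁ * K + 2 * C₂ * Real.sqrt e₀ + (3 * K * w / e₀ + 1) := by
  classical
  set rp : ℝ := ρ + w * ((4 : ℝ) ^ m)⁻¹ with hrp_def
  have hrp : 0 ≤ rp := by positivity
  set low : ℕ → Prop := fun n => K * rp / e₀ * (4 : ℝ) ^ n ≤ 1 with hlow_def
  rw [← sum_filter_add_sum_filter_not (range (m + 1)) low]
  -- LOW scales: below-resolution bound, two geometric sums
  have hLOW : ∑ n ∈ (range (m + 1)).filter low, phGainOf C₀ K C₁ C₂ w e₀ n m ρ ≤ 4 / 3 * C₀ + 4 / 3 := by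
    calc ∑ n ∈ (range (m + 1)).filter low, phGainOf C₀ K C₁ C₂ w e₀ n m ρ
        ≤ ∑ n ∈ (range (m + 1)).filter low, (C₀ * ((4 : ℝ) ^ n)⁻¹ + K * rp / e₀ * (4 : ℝ) ^ n) :=
          sum_le_sum fun n _ => klgp_phGainOf_le_below _ _ _ _ _ _ _ _ _
      _ = C₀ * ∑ n ∈ (range (m + 1)).filter low, ((4 : ℝ) ^ n)⁻¹ +
            ∑ n ∈ (range (m + 1)).filter low, K * rp / e₀ * (4 : ℝ) ^ n := by rw [sum_add_distrib, mul_sum]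
      _ ≤ C₀ * (4 / 3) + 4 / 3 := by
          refine add_le_add (mul_le_mul_of_nonneg_left ?_ hC₀) ?_
          · exact (sum_le_sum_of_subset_of_nonneg (filter_subset _ _) fun n _ _ => by positivity).trans
              (klgp_sum_range_inv_four_pow_le (m + 1))
          · exact klgp_sum_mul_four_pow_le _ (by positivity) fun n hn => (mem_filter.mp hn).2
      _ = 4 / 3 * C₀ + 4 / 3 := by ring
  -- HIGH scales
  have hHIGH : ∑ n ∈ (range (m + 1)).filter (fun n => ¬ low n), phGainOf C₀ K C₁ C₂ w e₀ n m ρ ≤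
      4 * C₁ * K + 2 * C₂ * Real.sqrt e₀ + (3 * K * w / e₀ + 1) := by
    by_cases hres : 2 * w * ((4 : ℝ) ^ m)⁻¹ ≤ ρ
    · -- resolved transfer: the above-resolution law, geometric from the first HIGH scale
      rcases ((range (m + 1)).filter (fun n => ¬ low n)).eq_empty_or_nonempty with h0 | hne
      · rw [h0, sum_empty]; positivity
      · obtain ⟨n₀, hn₀⟩ := hne
        have hn₀' : 1 < K * rp / e₀ * (4 : ℝ) ^ n₀ := lt_of_not_ge (mem_filter.mp hn₀).2
        have hrp0 : 0 < rp := by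
          by_contra hcon
          have : rp = 0 := le_antisymm (not_lt.mp hcon) hrp
          rw [this] at hn₀'; simp at hn₀'; linarith
        have hρ0 : 0 < ρ := by
          by_contra hcon
          have hρz : ρ = 0 := le_antisymm (not_lt.mp hcon) hρ
          have hwm : w * ((4 : ℝ) ^ m)⁻¹ = 0 := by
            have : 0 ≤ w * ((4 : ℝ) ^ m)⁻¹ := by positivity
            rw [hρz] at hres; linarith
          rw [hrp_def, hρz, hwm] at hrp0; simp at hrp0
        have hwρ : w * ((4 : ℝ) ^ m)⁻¹ < ρ := by
          have : 0 ≤ w * ((4 : ℝ) ^ m)⁻¹ := by positivity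
          linarith
        have hden : ρ / 2 ≤ ρ - w * ((4 : ℝ) ^ m)⁻¹ := by linarith
        have hrp32 : rp ≤ 3 / 2 * ρ := by rw [hrp_def]; linarith
        calc ∑ n ∈ (range (m + 1)).filter (fun n => ¬ low n), phGainOf C₀ K C₁ C₂ w e₀ n m ρ
            ≤ ∑ n ∈ (range (m + 1)).filter (fun n => ¬ low n),
                (2 * C₁ * e₀ / ρ * ((4 : ℝ) ^ n)⁻¹ + C₂ * Real.sqrt e₀ * ((2 : ℝ) ^ n)⁻¹) := by
              refine sum_le_sum fun n _ => (klgp_phGainOf_le_above _ _ _ _ _ _ n m hwρ).trans (add_le_add ?_ le_rfl)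
              have hnum : 0 ≤ C₁ * (e₀ * ((4 : ℝ) ^ n)⁻¹) := by positivity
              calc C₁ * (e₀ * ((4 : ℝ) ^ n)⁻¹) / (ρ - w * ((4 : ℝ) ^ m)⁻¹)
                  ≤ C₁ * (e₀ * ((4 : ℝ) ^ n)⁻¹) / (ρ / 2) := div_le_div_of_nonneg_left hnum (by positivity) hden
                _ = 2 * C₁ * e₀ / ρ * ((4 : ℝ) ^ n)⁻¹ := by rw [div_div_eq_mul_div]; ring
          _ = 2 * C₁ * e₀ / ρ * ∑ n ∈ (range (m + 1)).filter (fun n => ¬ low n), ((4 : ℝ) ^ n)⁻¹ +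
                C₂ * Real.sqrt e₀ * ∑ n ∈ (range (m + 1)).filter (fun n => ¬ low n), ((2 : ℝ) ^ n)⁻¹ := by
              rw [sum_add_distrib, mul_sum, mul_sum]
          _ ≤ 2 * C₁ * e₀ / ρ * (4 / 3 * (K * rp / e₀)) + C₂ * Real.sqrt e₀ * 2 := by
              refine add_le_add (mul_le_mul_of_nonneg_left ?_ (by positivity)) (mul_le_mul_of_nonneg_left ?_ (by positivity))
              · refine klgp_sum_inv_four_pow_le_of_le _ (by positivity) fun n hn => ?_
                have h1 : 1 < K * rp / e₀ * (4 : ℝ) ^ n := lt_of_not_ge (mem_filter.mp hn).2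
                have h4n : 0 < (4 : ℝ) ^ n := by positivity
                rw [inv_le_iff_one_le_mul₀ h4n]
                linarith [h1]
              · exact (sum_le_sum_of_subset_of_nonneg (filter_subset _ _) fun n _ _ => by positivity).trans
                  (klgp_sum_range_inv_two_pow_le (m + 1))
          _ = 8 / 3 * C₁ * K * (rp / ρ) + 2 * C₂ * Real.sqrt e₀ := by field_simp; ring
          _ ≤ 8 / 3 * C₁ * K * (3 / 2) + 2 * C₂ * Real.sqrt e₀ := by
              have hq : rp / ρ ≤ 3 / 2 := by rwa [div_le_iff₀ hρ0]
              have hck : 0 ≤ 8 / 3 * C₁ * K := by positivity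
              nlinarith [mul_le_mul_of_nonneg_left hq hck]
          _ = 4 * C₁ * K + 2 * C₂ * Real.sqrt e₀ := by ring
          _ ≤ 4 * C₁ * K + 2 * C₂ * Real.sqrt e₀ + (3 * K * w / e₀ + 1) := by
              have : 0 ≤ 3 * K * w / e₀ + 1 := by positivity
              linarith
    · -- unresolved transfer: at most `⌊3Kw/e₀⌋₊ + 1` HIGH scales, each `≤ 1`
      have hres' : ρ < 2 * w * ((4 : ℝ) ^ m)⁻¹ := lt_of_not_ge hres
      calc ∑ n ∈ (range (m + 1)).filter (fun n => ¬ low n), phGainOf C₀ K C₁ C₂ w e₀ n m ρ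
          ≤ ∑ n ∈ (range (m + 1)).filter (fun n => ¬ low n), (1 : ℝ) :=
            sum_le_sum fun n _ => klgp_phGainOf_le_one _ _ _ _ _ _ _ _ _
        _ = ((range (m + 1)).filter (fun n => ¬ low n)).card := by simp
        _ ≤ (Icc (m - ⌊3 * K * w / e₀⌋₊) m).card := by
            exact_mod_cast card_le_card fun n hn => by
              rw [mem_filter, mem_range] at hn
              rw [mem_Icc]
              refine ⟨klgp_unresolved_scale_ge hK he (Nat.le_of_lt_succ hn.1) hres' ?_, Nat.le_of_lt_succ hn.1⟩
              exact lt_of_not_ge hn.2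
        _ ≤ ⌊3 * K * w / e₀⌋₊ + 1 := by
            rw [Nat.card_Icc]
            have : m + 1 - (m - ⌊3 * K * w / e₀⌋₊) ≤ ⌊3 * K * w / e₀⌋₊ + 1 := by omega
            exact_mod_cast this
        _ ≤ 3 * K * w / e₀ + 1 := by linarith [Nat.floor_le (by positivity : 0 ≤ 3 * K * w / e₀)]
        _ ≤ 4 * C₁ * K + 2 * C₂ * Real.sqrt e₀ + (3 * K * w / e₀ + 1) := by
            have : 0 ≤ 4 * C₁ * K + 2 * C₂ * Real.sqrt e₀ := by positivity
            linarith
  linarith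

end Summit.HubbardSuperconductivity.HubbardSuperconductivity.Theorems

end
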